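import Summits.BirchSwinnertonDyer.Rank1Residual.X11b.Three.UnrSeriesTwist
import HarnessLib

/-!
# X11b — values of an element of `Λ_{R₀} = R₀⟦T⟧` near the trivial character, and the ABSTRACT CORE of
# value-at-𝟙 rigidity (S27 'V1RIG', any prime `p`): two series whose values along `T_k → 0` are tied by
# factors `a_k` (at `T_k`) and `a_k²` (at `(1+T_k)² − 1`) have the same constant term

HONEST FRAMING (cell `b2b-bsdres`, run/shared/lean/b2b/bsd-rank1-residual/, verbatim in every
file): the goal of the cell is to DELETE the COMBINATION-SHAPED residual classes of the
Birch–Swinnerton-Dyer formula for ALL analytic-rank `≤ 1` elliptic curves over `ℚ` — "full BSD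
formula for every rank `≤ 1` curve in class `C`" assembled STRICTLY from published theorems — so
that the rank-`≤ 1` remainder becomes exactly the CONSTRUCTION-SHAPED classes, which are TYPED
(missing-input `Prop`s), NOT attempted. This is not "finishing BSD". Team `x11b3` (N8/O2), deal S27
'V1RIG' STEP 2 (x11b3-lead GEN 7 R8-14 (e); STEP 1 = route planner 1's `V1RIG-SKETCH.lean`
9d18b197ebdae999), seat `b2b-bsdres-x11b3-p3`. THEOREMS ONLY (no definition, no named fact, no
`sorry`); pure `p`-adic analysis on `R₀⟦T⟧`, valid at every prime `p`; nothing about curves or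
`L`-functions is asserted; nothing is booked; no mark / label / count moves.

## What is proved (namespace `…X11b.Halves`, continuing `HalvesReceptacle` / `Three/UnrSeriesTwist`)

* §1 `norm_value_sub_constantCoeff_le` — `‖L(x) − [T⁰]L‖ ≤ ‖x‖` for `L ∈ R₀⟦T⟧`, `‖x‖ < 1`;
  `tendsto_value_constantCoeff` — `x_k → 0 ⇒ L(x_k) → [T⁰]L` (continuity of evaluation at `𝟙`);
  `eventually_norm_eq_of_tendsto` (ultrametric bookkeeping); `hasValueAt_X_pow`;
  `norm_value_eq_of_order` — for `F` of order `d` and `‖x‖ < ‖[T^d]F‖`: `‖F(x)‖ = ‖x‖^d·‖[T^d]F‖`.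
* §2 THE ABSTRACT CORE `constantCoeff_eq_of_values_mul_sq` (+ the one-sided
  `…_of_ne_zero`): along `T_k → 0`, if `L, L'` take the values `v_k`, `a_k·v_k` at `T_k` and `w_k`,
  `a_k²·w_k` at `T_k·(T_k + 2) = (1 + T_k)² − 1`, with `a_k ≠ 0`, then `[T⁰]L' = [T⁰]L`. PROOF (no
  identity principle, no rate estimate): all four value sequences converge to the constant terms
  `c, c'` (§1); if `c ≠ 0` then `a_k → ρ := c'/c` and `a_k² → ρ`, so `ρ² = ρ`; `ρ = 0` is
  impossible — then `c' = 0`, `L' ≠ 0`, and the ORDER LEMMA at `T_k` and at `T_k(T_k + 2)` gives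
  `‖a_k‖ = ‖T_k + 2‖^d = ‖2‖^d ≠ 0` for large `k`, against `a_k → 0` —; hence `ρ = 1`, `c' = c`; if
  `c = 0 ≠ c'` swap the series (`a_k ↦ a_k⁻¹`). Consumer: `X11b/BDPValueRigidity.lean`
  (`constantCoeff_eq_of_isBDPLFunction_of_supply`, the S27 statement over `IsBDPLFunction`).

References: [Cassels1986] Ch. 4 (power series on the open disc: convergence, size of values);
[Castella2018] §2.2 (values of elements of `Λ` at characters, `1 + T ↦ γ`).
-/

noncomputable section

open scoped Classical Topology

open Filter WeierstrassCurve NumberField IsDedekindDomain Field PowerSeries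
  Literature.NumberTheory.EllipticCurves Literature.NumberTheory.GaloisRepresentations

/-! ### §1 Values of `L ∈ R₀⟦T⟧` near the trivial character -/

namespace Summit.BirchSwinnertonDyer.Rank1Residual.X11b.Halves

variable {p : ℕ} [Fact p.Prime]

/-- **`‖L(x) − L(𝟙)‖ ≤ ‖x‖` on the open unit disc**: for `L ∈ R₀⟦T⟧` and `‖x‖ < 1`, the value
`L(x) = ∑ [T^k]L·x^k` differs from the constant term `[T⁰]L = L(0)` by `∑_{k ≥ 1} [T^k]L·x^k`, each
term of norm `≤ ‖x‖^k ≤ ‖x‖` (`‖R₀‖ ≤ 1`), hence of norm `≤ ‖x‖` (ultrametric inequality for sums in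
`ℂ_p`). [cite: Cassels1986, Ch. 4 Lemma 2.1 (convergence and size of power-series values on the open disc)] -/
theorem norm_value_sub_constantCoeff_le {L : UnrSeries p} {x v : ℂ_[p]} (hx : ‖x‖ < 1)
    (hL : L.HasValueAt x v) :
    ‖v - ((PowerSeries.constantCoeff L : unrIntegers p) : ℂ_[p])‖ ≤ ‖x‖ := by
  set f : ℕ → ℂ_[p] := fun k ↦ ((PowerSeries.coeff k L : unrIntegers p) : ℂ_[p]) * x ^ k with hf
  have hsum : HasSum f v := hL
  have htail : HasSum (fun k ↦ f (k + 1)) (v - f 0) := by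
    have h := (hasSum_nat_add_iff' 1).mpr hsum
    simpa [Finset.sum_range_one] using h
  have hf0 : f 0 = ((PowerSeries.constantCoeff L : unrIntegers p) : ℂ_[p]) := by
    simp [hf, PowerSeries.coeff_zero_eq_constantCoeff]
  rw [← hf0, ← htail.tsum_eq]
  refine IsUltrametricDist.norm_tsum_le_of_forall_le_of_nonneg (norm_nonneg x) fun k ↦ ?_
  rw [hf, norm_mul, norm_pow, pow_succ]
  calc ‖((PowerSeries.coeff (k + 1) L : unrIntegers p) : ℂ_[p])‖ * (‖x‖ ^ k * ‖x‖)
      ≤ 1 * (1 * ‖x‖) := by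
        gcongr
        · exact norm_coe_unrIntegers_le_one p _
        · exact pow_le_one₀ (norm_nonneg _) hx.le
    _ = ‖x‖ := by ring

/-- **Continuity of evaluation at the trivial character**: if `x_k → 0` and `L` has value `v_k` at
`x_k` (all `k`), then `v_k → [T⁰]L = L(𝟙)` (eventually `‖x_k‖ < 1` and `‖v_k − [T⁰]L‖ ≤ ‖x_k‖`).
[cite: Cassels1986, Ch. 4 Lemma 2.1] -/
theorem tendsto_value_constantCoeff {L : UnrSeries p} {x v : ℕ → ℂ_[p]}
    (hx0 : Tendsto x atTop (𝓝 0)) (hL : ∀ k, L.HasValueAt (x k) (v k)) :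
    Tendsto v atTop (𝓝 ((PowerSeries.constantCoeff L : unrIntegers p) : ℂ_[p])) := by
  rw [tendsto_iff_norm_sub_tendsto_zero]
  have hx0' : Tendsto (fun k ↦ ‖x k‖) atTop (𝓝 0) := tendsto_zero_iff_norm_tendsto_zero.mp hx0
  have hev : ∀ᶠ k in atTop, ‖x k‖ < 1 := Filter.Tendsto.eventually_lt_const zero_lt_one hx0'
  refine squeeze_zero' (Eventually.of_forall fun k ↦ norm_nonneg _) ?_ hx0'
  filter_upwards [hev] with k hk using norm_value_sub_constantCoeff_le hk (hL k)

/-- Ultrametric bookkeeping: a sequence of `ℂ_p` converging to `c ≠ 0` has norm EVENTUALLY EQUAL to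
`‖c‖`. [folklore] -/
theorem eventually_norm_eq_of_tendsto {v : ℕ → ℂ_[p]} {c : ℂ_[p]} (hc : c ≠ 0)
    (hv : Tendsto v atTop (𝓝 c)) : ∀ᶠ k in atTop, ‖v k‖ = ‖c‖ := by
  have h : Tendsto (fun k ↦ ‖v k - c‖) atTop (𝓝 0) := (tendsto_iff_norm_sub_tendsto_zero).mp hv
  filter_upwards [Filter.Tendsto.eventually_lt_const (norm_pos_iff.mpr hc) h] with k hk
  calc ‖v k‖ = ‖(v k - c) + c‖ := by rw [sub_add_cancel]
    _ = max ‖v k - c‖ ‖c‖ := IsUltrametricDist.norm_add_eq_max_of_norm_ne_norm (ne_of_lt hk)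
    _ = ‖c‖ := max_eq_right hk.le

/-- The monomial `T^d ∈ R₀⟦T⟧` has value `x^d` at `x`. [folklore] -/
theorem hasValueAt_X_pow (d : ℕ) (x : ℂ_[p]) :
    UnrSeries.HasValueAt ((PowerSeries.X : UnrSeries p) ^ d) x (x ^ d) := by
  unfold UnrSeries.HasValueAt
  have h := hasSum_single (f := fun k : ℕ ↦
    ((PowerSeries.coeff k ((PowerSeries.X : UnrSeries p) ^ d) : unrIntegers p) : ℂ_[p]) * x ^ k) d
    (fun k hk ↦ by simp [PowerSeries.coeff_X_pow, hk])
  simpa [PowerSeries.coeff_X_pow] using h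

/-- **Order controls the size of values near `0`.** For `F ∈ R₀⟦T⟧` of order `d` (`F = T^d·g`,
`g(0) = [T^d]F`; for `F ≠ 0` this is the first non-zero coefficient): at every `x` with `‖x‖ < 1` and
`‖x‖ < ‖[T^d]F‖` the value satisfies `‖F(x)‖ = ‖x‖^d·‖[T^d]F‖` (`F(x) = x^d·g(x)` by the product rule
on the open disc and `‖g(x)‖ = ‖g(0)‖` ultrametrically). [cite: Cassels1986, Ch. 4 Lemma 2.1] -/
theorem norm_value_eq_of_order {F : UnrSeries p} {x u : ℂ_[p]} (hx : ‖x‖ < 1)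
    (hxg : ‖x‖ < ‖((PowerSeries.coeff F.order.toNat F : unrIntegers p) : ℂ_[p])‖)
    (hu : F.HasValueAt x u) :
    ‖u‖ = ‖x‖ ^ F.order.toNat *
      ‖((PowerSeries.coeff F.order.toNat F : unrIntegers p) : ℂ_[p])‖ := by
  set d := F.order.toNat with hd
  obtain ⟨g, hg⟩ := PowerSeries.X_pow_order_dvd (φ := F)
  have hg0 : PowerSeries.constantCoeff g = PowerSeries.coeff d F := by
    rw [← PowerSeries.coeff_zero_eq_constantCoeff_apply, hg, ← hd]
    simpa using (PowerSeries.coeff_X_pow_mul g d 0).symm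
  obtain ⟨ug, hug⟩ := exists_hasValueAt g hx
  have hval : F.HasValueAt x (x ^ d * ug) := by
    rw [hg, ← hd]
    exact hasValueAt_mul hx (hasValueAt_X_pow d x) hug
  have hu' : u = x ^ d * ug := hu.unique hval
  have hg0' : ((PowerSeries.constantCoeff g : unrIntegers p) : ℂ_[p]) =
      ((PowerSeries.coeff d F : unrIntegers p) : ℂ_[p]) := by rw [hg0]
  have hne : ((PowerSeries.coeff d F : unrIntegers p) : ℂ_[p]) ≠ 0 := by
    intro h0
    rw [h0, norm_zero] at hxg
    exact (norm_nonneg x).not_gt hxg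
  have hnear : ‖ug - ((PowerSeries.coeff d F : unrIntegers p) : ℂ_[p])‖ <
      ‖((PowerSeries.coeff d F : unrIntegers p) : ℂ_[p])‖ :=
    (hg0' ▸ norm_value_sub_constantCoeff_le hx hug).trans_lt hxg
  have hug_norm : ‖ug‖ = ‖((PowerSeries.coeff d F : unrIntegers p) : ℂ_[p])‖ := by
    calc ‖ug‖ = ‖(ug - ((PowerSeries.coeff d F : unrIntegers p) : ℂ_[p])) +
          ((PowerSeries.coeff d F : unrIntegers p) : ℂ_[p])‖ := by rw [sub_add_cancel]
      _ = max ‖ug - ((PowerSeries.coeff d F : unrIntegers p) : ℂ_[p])‖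
          ‖((PowerSeries.coeff d F : unrIntegers p) : ℂ_[p])‖ :=
            IsUltrametricDist.norm_add_eq_max_of_norm_ne_norm (ne_of_lt hnear)
      _ = ‖((PowerSeries.coeff d F : unrIntegers p) : ℂ_[p])‖ := max_eq_right hnear.le
  rw [hu', norm_mul, norm_pow, hug_norm]

end Summit.BirchSwinnertonDyer.Rank1Residual.X11b.Halves

/-! ### §2 The abstract core: values tied by `a_k` and `a_k²` along `T_k → 0` -/

namespace Summit.BirchSwinnertonDyer.Rank1Residual.X11b.Halves

variable {p : ℕ} [Fact p.Prime]

/-- The zero series has value `0` everywhere. [folklore] -/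
theorem hasValueAt_zero_series (x : ℂ_[p]) : UnrSeries.HasValueAt (0 : UnrSeries p) x 0 := by
  unfold UnrSeries.HasValueAt
  simp

/-- **Abstract core, one-sided** (`[T⁰]L ≠ 0`). Along `T_k → 0` let `L, L' ∈ R₀⟦T⟧` take the
values `v_k`, `a_k·v_k` at `T_k` and `w_k`, `a_k²·w_k` at `T'_k := T_k·(T_k + 2) = (1 + T_k)² − 1`,
with `a_k ≠ 0`. Then `[T⁰]L' = [T⁰]L`. PROOF: all four value sequences converge to the constant terms
`c ≠ 0`, `c'` (§1); hence `a_k → ρ := c'/c` and `a_k² → ρ`, so `ρ² = ρ`. If `ρ = 0` then `c' = 0` and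
`a_k → 0`; but `L' ≠ 0` (its value `a_k v_k ≠ 0` for large `k`), so with `d` the order of `L'` and
`g₀ = [T^d]L'` the ORDER LEMMA (`norm_value_eq_of_order`) gives, for large `k`,
`‖a_k‖‖c‖ = ‖T_k‖^d‖g₀‖` and `‖a_k‖²‖c‖ = ‖T_k‖^d‖T_k + 2‖^d‖g₀‖ = ‖T_k‖^d‖2‖^d‖g₀‖`, i.e.
`‖a_k‖ = ‖2‖^d ≠ 0` — contradiction. So `ρ = 1` and `c' = c`. [folklore] -/
theorem constantCoeff_eq_of_values_mul_sq_of_ne_zero {L L' : UnrSeries p} {T v w a : ℕ → ℂ_[p]}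
    (hT0 : Tendsto T atTop (𝓝 0)) (ha : ∀ k, a k ≠ 0)
    (hv : ∀ k, L.HasValueAt (T k) (v k)) (hv' : ∀ k, L'.HasValueAt (T k) (a k * v k))
    (hw : ∀ k, L.HasValueAt (T k * (T k + 2)) (w k))
    (hw' : ∀ k, L'.HasValueAt (T k * (T k + 2)) (a k ^ 2 * w k))
    (hc : PowerSeries.constantCoeff L ≠ 0) :
    PowerSeries.constantCoeff L' = PowerSeries.constantCoeff L := by
  set c : ℂ_[p] := ((PowerSeries.constantCoeff L : unrIntegers p) : ℂ_[p]) with hcdef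
  set c' : ℂ_[p] := ((PowerSeries.constantCoeff L' : unrIntegers p) : ℂ_[p]) with hc'def
  have hc0 : c ≠ 0 := by
    rw [hcdef, Ne, ZeroMemClass.coe_eq_zero]
    exact hc
  have hT2 : Tendsto (fun k ↦ T k + 2) atTop (𝓝 2) := by simpa using hT0.add_const 2
  have hT'0 : Tendsto (fun k ↦ T k * (T k + 2)) atTop (𝓝 0) := by simpa using hT0.mul hT2
  -- (i) the four limits
  have hv_lim : Tendsto v atTop (𝓝 c) := tendsto_value_constantCoeff hT0 hv
  have hw_lim : Tendsto w atTop (𝓝 c) := tendsto_value_constantCoeff hT'0 hw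
  have hav_lim : Tendsto (fun k ↦ a k * v k) atTop (𝓝 c') := tendsto_value_constantCoeff hT0 hv'
  have haw_lim : Tendsto (fun k ↦ a k ^ 2 * w k) atTop (𝓝 c') :=
    tendsto_value_constantCoeff hT'0 hw'
  have hvne : ∀ᶠ k in atTop, v k ≠ 0 := by
    filter_upwards [eventually_norm_eq_of_tendsto hc0 hv_lim] with k hk
    rw [← norm_ne_zero_iff, hk, norm_ne_zero_iff]
    exact hc0
  have hwne : ∀ᶠ k in atTop, w k ≠ 0 := by
    filter_upwards [eventually_norm_eq_of_tendsto hc0 hw_lim] with k hk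
    rw [← norm_ne_zero_iff, hk, norm_ne_zero_iff]
    exact hc0
  -- (ii) `a_k → ρ` and `a_k² → ρ`
  set ρ : ℂ_[p] := c' / c with hρdef
  have ha_lim : Tendsto a atTop (𝓝 ρ) := by
    refine (hav_lim.div hv_lim hc0).congr' ?_
    filter_upwards [hvne] with k hk
    simp only [Pi.div_apply]
    exact mul_div_cancel_right₀ (a k) hk
  have ha2_lim : Tendsto (fun k ↦ a k ^ 2) atTop (𝓝 ρ) := by
    refine (haw_lim.div hw_lim hc0).congr' ?_
    filter_upwards [hwne] with k hk
    simp only [Pi.div_apply]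
    exact mul_div_cancel_right₀ (a k ^ 2) hk
  have hρsq : ρ ^ 2 = ρ := tendsto_nhds_unique (ha_lim.pow 2) ha2_lim
  have hc'ρ : c' = ρ * c := by rw [hρdef, div_mul_cancel₀ _ hc0]
  have hρ01 : ρ = 0 ∨ ρ = 1 := by
    have h : ρ * (ρ - 1) = 0 := by rw [mul_sub, mul_one, ← sq, hρsq, sub_self]
    rcases mul_eq_zero.mp h with h | h
    · exact Or.inl h
    · exact Or.inr (sub_eq_zero.mp h)
  rcases hρ01 with hρ0 | hρ1
  · -- (ii') `ρ = 0` is impossible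
    exfalso
    have hc'0 : c' = 0 := by rw [hc'ρ, hρ0, zero_mul]
    have ha0 : Tendsto a atTop (𝓝 0) := hρ0 ▸ ha_lim
    obtain ⟨K, hK⟩ := hvne.exists
    have hL'ne : L' ≠ 0 := by
      intro h0
      have h00 := hasValueAt_zero_series (p := p) (T K)
      rw [← h0] at h00
      exact mul_ne_zero (ha K) hK ((hv' K).unique h00)
    set d : ℕ := L'.order.toNat with hddef
    set g₀ : ℂ_[p] := ((PowerSeries.coeff d L' : unrIntegers p) : ℂ_[p]) with hg₀def
    have hg₀ : g₀ ≠ 0 := by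
      rw [hg₀def, Ne, ZeroMemClass.coe_eq_zero, hddef]
      exact PowerSeries.coeff_order hL'ne
    have hg₀pos : 0 < ‖g₀‖ := norm_pos_iff.mpr hg₀
    have h2pos : 0 < ‖(2 : ℂ_[p])‖ := norm_pos_iff.mpr two_ne_zero
    have h2d : 0 < ‖(2 : ℂ_[p])‖ ^ d := pow_pos h2pos d
    -- eventually-facts
    have hTn : Tendsto (fun k ↦ ‖T k‖) atTop (𝓝 0) := tendsto_zero_iff_norm_tendsto_zero.mp hT0
    have hT'n : Tendsto (fun k ↦ ‖T k * (T k + 2)‖) atTop (𝓝 0) :=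
      tendsto_zero_iff_norm_tendsto_zero.mp hT'0
    have han : Tendsto (fun k ↦ ‖a k‖) atTop (𝓝 0) := tendsto_zero_iff_norm_tendsto_zero.mp ha0
    have E1 : ∀ᶠ k in atTop, ‖T k‖ < 1 := hTn.eventually_lt_const zero_lt_one
    have E2 : ∀ᶠ k in atTop, ‖T k‖ < ‖g₀‖ := hTn.eventually_lt_const hg₀pos
    have E3 : ∀ᶠ k in atTop, ‖T k * (T k + 2)‖ < 1 := hT'n.eventually_lt_const zero_lt_one
    have E4 : ∀ᶠ k in atTop, ‖T k * (T k + 2)‖ < ‖g₀‖ := hT'n.eventually_lt_const hg₀pos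
    have E5 : ∀ᶠ k in atTop, ‖v k‖ = ‖c‖ := eventually_norm_eq_of_tendsto hc0 hv_lim
    have E6 : ∀ᶠ k in atTop, ‖w k‖ = ‖c‖ := eventually_norm_eq_of_tendsto hc0 hw_lim
    have E7 : ∀ᶠ k in atTop, ‖T k + 2‖ = ‖(2 : ℂ_[p])‖ :=
      eventually_norm_eq_of_tendsto two_ne_zero hT2
    have E8 : ∀ᶠ k in atTop, ‖a k‖ < ‖(2 : ℂ_[p])‖ ^ d := han.eventually_lt_const h2d
    obtain ⟨k, h1, h2, h3, h4, h5, h6, h7, h8⟩ :=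
      (E1.and (E2.and (E3.and (E4.and (E5.and (E6.and (E7.and E8))))))).exists
    have hA : ‖a k‖ * ‖c‖ = ‖T k‖ ^ d * ‖g₀‖ := by
      rw [← h5, ← norm_mul (a k) (v k)]
      exact norm_value_eq_of_order h1 h2 (hv' k)
    have hB : ‖a k‖ ^ 2 * ‖c‖ = ‖T k‖ ^ d * ‖(2 : ℂ_[p])‖ ^ d * ‖g₀‖ := by
      rw [← h7, ← mul_pow, ← norm_mul (T k) (T k + 2), ← h6, ← norm_pow (a k) 2,
        ← norm_mul (a k ^ 2) (w k)]
      exact norm_value_eq_of_order h3 h4 (hw' k)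
    have hB' : ‖a k‖ ^ 2 * ‖c‖ = ‖(2 : ℂ_[p])‖ ^ d * (‖a k‖ * ‖c‖) := by
      rw [hB, hA]; ring
    have hcpos : 0 < ‖c‖ := norm_pos_iff.mpr hc0
    have hak : ‖a k‖ = ‖(2 : ℂ_[p])‖ ^ d := by
      have hne : ‖a k‖ * ‖c‖ ≠ 0 := mul_ne_zero (norm_ne_zero_iff.mpr (ha k)) hcpos.ne'
      have : ‖a k‖ * (‖a k‖ * ‖c‖) = ‖(2 : ℂ_[p])‖ ^ d * (‖a k‖ * ‖c‖) := by rw [← hB']; ring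
      exact mul_right_cancel₀ hne this
    exact (lt_irrefl _) (hak ▸ h8)
  · -- (iii) `ρ = 1`: `c' = c`
    have hcc : c' = c := by rw [hc'ρ, hρ1, one_mul]
    exact Subtype.ext hcc

/-- **Abstract core (symmetric form).** As in the one-sided version, WITHOUT `[T⁰]L ≠ 0`: if `[T⁰]L = 0`
and `[T⁰]L' ≠ 0` swap the roles of the frames (`a_k ↦ a_k⁻¹`), and if both vanish there is nothing
to prove. [folklore] -/
theorem constantCoeff_eq_of_values_mul_sq {L L' : UnrSeries p} {T v w a : ℕ → ℂ_[p]}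
    (hT0 : Tendsto T atTop (𝓝 0)) (ha : ∀ k, a k ≠ 0)
    (hv : ∀ k, L.HasValueAt (T k) (v k)) (hv' : ∀ k, L'.HasValueAt (T k) (a k * v k))
    (hw : ∀ k, L.HasValueAt (T k * (T k + 2)) (w k))
    (hw' : ∀ k, L'.HasValueAt (T k * (T k + 2)) (a k ^ 2 * w k)) :
    PowerSeries.constantCoeff L' = PowerSeries.constantCoeff L := by
  by_cases hc : PowerSeries.constantCoeff L = 0
  · by_cases hc' : PowerSeries.constantCoeff L' = 0
    · rw [hc, hc']
    · refine (constantCoeff_eq_of_values_mul_sq_of_ne_zero (L := L') (L' := L)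
        (a := fun k ↦ (a k)⁻¹) (v := fun k ↦ a k * v k) (w := fun k ↦ a k ^ 2 * w k)
        hT0 (fun k ↦ inv_ne_zero (ha k)) hv' (fun k ↦ ?_) hw' (fun k ↦ ?_) hc').symm
      · simpa only [inv_mul_cancel_left₀ (ha k)] using hv k
      · have h : (a k)⁻¹ ^ 2 * (a k ^ 2 * w k) = w k := by
          rw [← mul_assoc, ← mul_pow, inv_mul_cancel₀ (ha k), one_pow, one_mul]
        simpa only [h] using hw k
  · exact constantCoeff_eq_of_values_mul_sq_of_ne_zero hT0 ha hv hv' hw hw' hc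

end Summit.BirchSwinnertonDyer.Rank1Residual.X11b.Halves

end
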